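import Literature.Geometry.Lorentzian.Basic
import Literature.Geometry.Lorentzian.CoordCurvature
import HarnessLib

/-!
# Crux `GapExhaustion` (stmt-FinalStateConjecture-10808), line `photon-shell-pseudoconvexity`:
# stub (K-E) `stub_killingPatching_of` — two coordinate Killing fields agreeing on an open subset
# of a connected open set agree everywhere (the PATCHING form of unique continuation)

Route `BartnikGapSettling`; helper (`--supports stmt-FinalStateConjecture-10808`) landing the
registered sub-stub (K-E) of line lead c8, wave 2. The Ionescu–Klainerman sweeps (S3/S5/S6b of the
line) build a global Killing extension by patching LOCAL extensions across a hypersurface; two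
local extensions defined near different points of the leaf must agree on the overlap of their
domains because both agree with the already-extended field on the swept side. This is the form in
which unique continuation is consumed: from (K-D) (`stub_killingUniqueContinuation_of`, the
vanishing form: zero 1-jet at one point of a connected open set ⇒ zero), taken here as the
hypothesis, we deduce: two `C²` solutions of the coordinate Killing equation on a connected open
`V` that agree on a nonempty open `U ⊆ V` agree on `V` (their difference is a Killing field that
vanishes on `U`, hence has zero 1-jet at a point of `U`). O'Neill 1983, Ch. 9, Lemma 9.27 (local
form). Mathlib + the tree's `IsMetricOn` only.
-/

noncomputable section

-- instance search through the nested operator types `E4 →L[ℝ] E4 →L[ℝ] E4 →L[ℝ] ℝ`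
set_option maxSynthPendingDepth 3

-- D-0017: single-problem summit, `Summit.<S>.<S>.…` by design (cf. lakefile `weak.linter.dupNamespace`).
set_option linter.dupNamespace false

namespace Summit.FinalStateConjecture.FinalStateConjecture.Theorems

open Set Filter
open Literature.Geometry.Lorentzian Literature.Geometry.Lorentzian.MetricCoord
open scoped Topology

/-- **Stub (K-E) of the line `photon-shell-pseudoconvexity` (crux `GapExhaustion`,
stmt-FinalStateConjecture-10808) — patching of coordinate Killing fields.** Assume the vanishing
form of unique continuation (K-D): a `C²` solution of the coordinate Killing equation on a
connected open set with zero 1-jet at one of its points vanishes identically. Then for the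
components `G` of a pseudo-Riemannian metric on the connected open set `V ⊆ E4` and two `C²`
solutions `K₁, K₂` of the coordinate Killing equation
`DG(x)(K x)(Y,Z) + G x (DK(x) Y) Z + G x Y (DK(x) Z) = 0` on `V` which agree on a nonempty open
subset `U ⊆ V`: `K₁ = K₂` on `V` (O'Neill 1983, Ch. 9, Lemma 9.27, local form: the Killing
equation is linear, `K₁ − K₂` vanishes on the open `U`, so its 1-jet vanishes at a point of `U`).
[cite: ONeill1983, Ch. 9, Lemma 9.27] -/
theorem stub_killingPatching_of :
    (∀ (G : E4 → E4 →L[ℝ] E4 →L[ℝ] ℝ) (V : Set E4) (K : E4 → E4) (x₀ : E4),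
      IsMetricOn G V → IsConnected V → ContDiffOn ℝ 2 K V →
      (∀ x ∈ V, ∀ Y Z : E4,
        fderiv ℝ G x (K x) Y Z + G x (fderiv ℝ K x Y) Z + G x Y (fderiv ℝ K x Z) = 0) →
      x₀ ∈ V → K x₀ = 0 → fderiv ℝ K x₀ = 0 →
      ∀ x ∈ V, K x = 0) →
    ∀ (G : E4 → E4 →L[ℝ] E4 →L[ℝ] ℝ) (V U : Set E4) (K₁ K₂ : E4 → E4),
      IsMetricOn G V → IsConnected V → IsOpen U → U ⊆ V → U.Nonempty →
      ContDiffOn ℝ 2 K₁ V → ContDiffOn ℝ 2 K₂ V →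
      (∀ x ∈ V, ∀ Y Z : E4,
        fderiv ℝ G x (K₁ x) Y Z + G x (fderiv ℝ K₁ x Y) Z + G x Y (fderiv ℝ K₁ x Z) = 0) →
      (∀ x ∈ V, ∀ Y Z : E4,
        fderiv ℝ G x (K₂ x) Y Z + G x (fderiv ℝ K₂ x Y) Z + G x Y (fderiv ℝ K₂ x Z) = 0) →
      (∀ x ∈ U, K₁ x = K₂ x) →
      ∀ x ∈ V, K₁ x = K₂ x := by
  intro hUC G V U K₁ K₂ hG hconn hU hUV hUne hK₁ hK₂ hKil₁ hKil₂ hagree x hx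
  obtain ⟨x₀, hx₀⟩ := hUne
  -- the difference is a `C²` Killing field on `V`
  set K : E4 → E4 := fun y => K₁ y - K₂ y with hKdef
  have hK : ContDiffOn ℝ 2 K V := hK₁.sub hK₂
  have hdiff : ∀ y ∈ V, fderiv ℝ K y = fderiv ℝ K₁ y - fderiv ℝ K₂ y := by
    intro y hy
    have h₁ : DifferentiableAt ℝ K₁ y :=
      ((hK₁ y hy).contDiffAt (hG.mem_nhds hy)).differentiableAt two_ne_zero
    have h₂ : DifferentiableAt ℝ K₂ y :=
      ((hK₂ y hy).contDiffAt (hG.mem_nhds hy)).differentiableAt two_ne_zero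
    exact fderiv_fun_sub h₁ h₂
  have hKil : ∀ y ∈ V, ∀ Y Z : E4,
      fderiv ℝ G y (K y) Y Z + G y (fderiv ℝ K y Y) Z + G y Y (fderiv ℝ K y Z) = 0 := by
    intro y hy Y Z
    have h₁ := hKil₁ y hy Y Z
    have h₂ := hKil₂ y hy Y Z
    rw [hdiff y hy]
    simp only [hKdef, map_sub, sub_apply]
    linarith
  -- zero 1-jet at `x₀ ∈ U`
  have h0 : K x₀ = 0 := by
    simp only [hKdef, hagree x₀ hx₀, sub_self]
  have hev : K =ᶠ[𝓝 x₀] fun _ => (0 : E4) :=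
    (hU.mem_nhds hx₀) |> fun h => Filter.mem_of_superset h fun y hy => by
      simp only [mem_setOf_eq, hKdef, hagree y hy, sub_self]
  have h1 : fderiv ℝ K x₀ = 0 := by
    rw [hev.fderiv_eq]
    exact fderiv_const_apply 0
  have hzero := hUC G V K x₀ hG hconn hK hKil (hUV hx₀) h0 h1 x hx
  exact sub_eq_zero.1 hzero

end Summit.FinalStateConjecture.FinalStateConjecture.Theorems

end
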